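import Summits.Ventures.LatticeQCDFlow.Exactness.IMHAcceptanceWeightOrder
import Summits.Ventures.LatticeQCDFlow.Exactness.GaussianDeltaHModel
import Literature.Probability.HeavyTails.LogNormalTailHillTarget
import HarnessLib

/-!
# The exact free-field check of the flow arm, II: a BIASED Gaussian flow `N(μ, s)` on the mode
# `N(0, s)` is accepted with probability EXACTLY `ā = 2Φ(−|μ|/√(2s))` — the `erfc` law in the
# mean violation `⟨ΔH⟩ = μ²/s`, NOT the `arctan` law of a width error

HONEST FRAMING: exact (Metropolis-corrected) sampling algorithms for lattice gauge theory;
figures of merit are autocorrelation/cost numbers at stated couplings and volumes; no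
continuum-physics claim.  (SCALAR calibration rung S0-A: not a gauge result.)

Venture `LatticeQCDFlow` (cell pub-lqcd), topic `Exactness`; FANOUT row 2 (`s0-phi4`, FLOW arm; the
row's battery item "exact free-field limit check").  NEW WORK of the cell composing row 2's
`IMHAcceptanceWeightOrder.imh_meanAccept_eq_integral_swap` (the equilibrium acceptance of the exact
flow sampler is the involutive acceptance of the SWAP on `X × X`) with the tree's Gaussian `ΔH` model
`GaussianDeltaHModel` (`∫ min(1,e^{−h}) dN(m, 2m) = 2Φ(−√(m/2))`) and Mathlib's Gaussian algebra
(`gaussianReal_conv_gaussianReal`, `gaussianReal_map_neg`, `gaussianReal_map_const_mul`).  Nothing is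
cited as a fact; no definition; no printed counterpart is claimed (an elementary closed form serving
as a CERTIFIED TEST VALUE for the calibration engine's acceptance column: flow arm at `λ = 0`, a flow
of the right width whose mean on one mode is off by `μ`).

ROUTE.  The weight `b = p_{0,s}/p_{μ,s} = exp((μ² − 2μx)/(2s))` has a log LINEAR in `x`, so the
swap's violation `ΔH(x, y) = log b(x) − log b(y) = (μ/s)(y − x)` is GAUSSIAN under
`N(0,s) ⊗ N(μ,s)`: `Y − X ∼ N(μ, 2s)`, `ΔH ∼ N(μ²/s, 2μ²/s)` — Creutz's constraint `Var = 2·mean`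
holds on the nose (as it must for a Gaussian violation, `Phi4HMCFluctuationRelation`) — and the
acceptance is the Gaussian model's `2Φ(−√(m/2))` at `m = μ²/s`, i.e. `2Φ(−|μ|/√(2s))`.

## What is proved (`s : ℝ≥0`, `s ≠ 0`, `μ : ℝ`; target weight `gaussianPDFReal 0 s`, model
`gaussianPDFReal μ s`, Lebesgue reference measure, `imhAcceptQ` of `FlowSamplerOperator`)

* §1 `gaussianShift_weight_eq`, **`gaussianShift_deltaH_eq`** (`ΔH = (μ/s)(y − x)`);
* §2 `gaussianPair_map_snd_sub_fst` (`(N(m,s) ⊗ N(μ,t)) ∘ (y − x)⁻¹ = N(μ − m, s + t)`),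
  **`gaussianShift_deltaH_law`** (`ΔH ∼ N(μ²/s, 2μ²/s)` under `N(0,s) ⊗ N(μ,s)`),
  `integral_mul_gaussianPair_densities` (bookkeeping: `p_{0,s}(x)p_{μ,s}(y) dx dy` is the pair law);
* §3 `gaussianShift_meanAccept_eq_integral_law` (`ā = ∫ min(1,e^{−h}) dN(μ²/s, 2μ²/s)`),
  **`gaussianShift_meanAccept`** — `ā = 2Φ(−|μ|/√(2s))` (all `μ`; `μ = 0` is the perfect model, `ā = 1`),
  **`gaussianShift_meanDeltaH`** — `⟨ΔH⟩ = μ²/s`, and **`gaussianShift_meanAccept_eq_meanEnergyViolation`**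
  — `ā = 2Φ(−√(⟨ΔH⟩/2))` with the floor `1 − √(⟨ΔH⟩/π) ≤ ā` (`…_ge`);
* §4 **`biasLaw_lt_widthLaw_at_two`**: at the SAME mean violation `⟨ΔH⟩ = 2` the bias law gives
  `2Φ(−1) < 1/2` while the width law of `GaussianFlowModeAcceptance` (`1 − (2/π)·arctan √(⟨ΔH⟩/2)`,
  staged in row 2's custody at the time of writing) gives exactly `1/2`: ON THE FLOW ARM THE ACCEPTANCE
  COLUMN IS NOT A FUNCTION OF `⟨ΔH⟩` ALONE — a typed caution for reading acceptance as "the" violation.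

Reading for S0-A (no numerics implied beyond the displayed constants): a flow with the right covariance
but a bias of `μ = σ/2` on a mode (`⟨ΔH⟩ = 1/4`) is accepted there with probability `2Φ(−1/(2√2)) ≈ 0.72`;
`μ = σ` (`⟨ΔH⟩ = 1`) gives `2Φ(−1/√2) ≈ 0.48`.  NOT CLAIMED: several modes; simultaneous bias and width
error (the order events are then non-central — no closed form is asserted); anything about `τ_int`;
any value for a trained network.
-/

namespace Summit.Ventures.LatticeQCDFlow.Exactness

open Real MeasureTheory ProbabilityTheory Filter Set
open scoped NNReal ENNReal

section GaussianShift

variable {s : ℝ≥0}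

/-! ## §1 The weight and the violation of a biased Gaussian flow -/

/-- `b(x) = p_{0,s}(x)/p_{μ,s}(x) = exp((μ² − 2μx)/(2s))`. -/
theorem gaussianShift_weight_eq (hs : s ≠ 0) (μ x : ℝ) :
    gaussianPDFReal 0 s x / gaussianPDFReal μ s x = Real.exp ((μ ^ 2 - 2 * μ * x) / (2 * s)) := by
  have hs' : (0 : ℝ) < s := by exact_mod_cast pos_iff_ne_zero.mpr hs
  have hc : (Real.sqrt (2 * π * s))⁻¹ ≠ 0 := inv_ne_zero (Real.sqrt_pos.mpr (by positivity)).ne'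
  simp only [gaussianPDFReal_def, sub_zero]
  rw [mul_div_mul_left _ _ hc, ← Real.exp_sub]
  congr 1
  field_simp
  ring

/-- **The swap's violation is linear**: `ΔH(x, y) = log b(x) − log b(y) = (μ/s)(y − x)`. -/
theorem gaussianShift_deltaH_eq (hs : s ≠ 0) (μ : ℝ) (z : ℝ × ℝ) :
    deltaH (fun z : ℝ × ℝ => -Real.log (gaussianPDFReal 0 s z.1) - Real.log (gaussianPDFReal μ s z.2))
        Prod.swap z = μ / s * (z.2 - z.1) := by
  rw [deltaH_swap_eq (fun x => gaussianPDFReal_pos 0 s x hs) (fun x => gaussianPDFReal_pos μ s x hs),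
    gaussianShift_weight_eq hs, gaussianShift_weight_eq hs, Real.log_exp, Real.log_exp]
  have hs' : (s : ℝ) ≠ 0 := by exact_mod_cast hs
  field_simp
  ring

/-! ## §2 The law of the violation: `ΔH ∼ N(μ²/s, 2μ²/s)` -/

/-- Difference of an independent Gaussian pair: `(N(m,s) ⊗ N(μ,t)) ∘ (y − x)⁻¹ = N(μ − m, s + t)`
(reflection of the first factor, then `gaussianReal_conv_gaussianReal`). -/
theorem gaussianPair_map_snd_sub_fst (m μ : ℝ) (s t : ℝ≥0) :
    ((gaussianReal m s).prod (gaussianReal μ t)).map (fun z : ℝ × ℝ => z.2 - z.1)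
      = gaussianReal (μ - m) (s + t) := by
  have h1 : (fun z : ℝ × ℝ => z.2 - z.1)
      = (fun z : ℝ × ℝ => z.1 + z.2) ∘ (Prod.map (fun x : ℝ => -x) id) := by
    funext z
    simp only [Function.comp_apply, Prod.map, id]
    ring
  have hadd : Measurable (fun z : ℝ × ℝ => z.1 + z.2) := measurable_fst.add measurable_snd
  have hneg : Measurable (fun x : ℝ => -x) := measurable_neg
  have hpm : Measurable (Prod.map (fun x : ℝ => -x) (id : ℝ → ℝ)) := hneg.prodMap measurable_id
  rw [h1, ← Measure.map_map hadd hpm, ← Measure.map_prod_map _ _ hneg measurable_id, gaussianReal_map_neg,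
    Measure.map_id]
  show (gaussianReal (-m) s) ∗ (gaussianReal μ t) = _
  rw [gaussianReal_conv_gaussianReal]
  congr 1
  ring

/-- **`ΔH ∼ N(μ²/s, 2μ²/s)`** under the pair law `N(0,s) ⊗ N(μ,s)` — a Gaussian violation with
Creutz's constraint `Var = 2·mean`. -/
theorem gaussianShift_deltaH_law (hs : s ≠ 0) (μ : ℝ) :
    ((gaussianReal 0 s).prod (gaussianReal μ s)).map
        (deltaH (fun z : ℝ × ℝ => -Real.log (gaussianPDFReal 0 s z.1) - Real.log (gaussianPDFReal μ s z.2))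
          Prod.swap)
      = gaussianReal (μ ^ 2 / s) (2 * (μ ^ 2 / (s : ℝ))).toNNReal := by
  have e : deltaH (fun z : ℝ × ℝ => -Real.log (gaussianPDFReal 0 s z.1) - Real.log (gaussianPDFReal μ s z.2))
      Prod.swap = (fun h : ℝ => μ / s * h) ∘ (fun z : ℝ × ℝ => z.2 - z.1) :=
    funext (gaussianShift_deltaH_eq hs μ)
  have hmul : Measurable (fun h : ℝ => μ / s * h) := measurable_const_mul _
  have hsub : Measurable (fun z : ℝ × ℝ => z.2 - z.1) := measurable_snd.sub measurable_fst
  rw [e, ← Measure.map_map hmul hsub, gaussianPair_map_snd_sub_fst, gaussianReal_map_const_mul, sub_zero]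
  have hs' : (s : ℝ) ≠ 0 := by exact_mod_cast hs
  congr 1
  · ring
  · apply NNReal.eq
    rw [NNReal.coe_mul, NNReal.coe_mk, NNReal.coe_add, Real.coe_toNNReal _ (by positivity)]
    field_simp
    ring

/-- Bookkeeping: `g(x,y) p_{0,s}(x) p_{μ,s}(y) dx dy` is the expectation of `g` under the pair law. -/
theorem integral_mul_gaussianPair_densities (hs : s ≠ 0) (μ : ℝ) (g : ℝ × ℝ → ℝ) :
    ∫ z, g z * (gaussianPDFReal 0 s z.1 * gaussianPDFReal μ s z.2) ∂((volume : Measure ℝ).prod volume)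
      = ∫ z, g z ∂((gaussianReal 0 s).prod (gaussianReal μ s)) := by
  have hf : Measurable fun z : ℝ × ℝ => gaussianPDF 0 s z.1 * gaussianPDF μ s z.2 :=
    ((measurable_gaussianPDF 0 s).comp measurable_fst).mul ((measurable_gaussianPDF μ s).comp measurable_snd)
  rw [gaussianReal_of_var_ne_zero 0 hs, gaussianReal_of_var_ne_zero μ hs,
    prod_withDensity (measurable_gaussianPDF 0 s) (measurable_gaussianPDF μ s),
    integral_withDensity_eq_integral_toReal_smul hf
      (Eventually.of_forall fun z => ENNReal.mul_lt_top (by rw [gaussianPDF]; exact ENNReal.ofReal_lt_top)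
        (by rw [gaussianPDF]; exact ENNReal.ofReal_lt_top))]
  congr 1
  funext z
  rw [gaussianPDF, gaussianPDF, ← ENNReal.ofReal_mul (gaussianPDFReal_nonneg _ _ _),
    ENNReal.toReal_ofReal (mul_nonneg (gaussianPDFReal_nonneg _ _ _) (gaussianPDFReal_nonneg _ _ _)),
    smul_eq_mul, mul_comm]

/-! ## §3 The acceptance law `ā = 2Φ(−|μ|/√(2s))` -/

/-- The equilibrium acceptance is the Gaussian model's integral: `ā = ∫ min(1, e^{−h}) dN(μ²/s, 2μ²/s)`. -/
theorem gaussianShift_meanAccept_eq_integral_law (hs : s ≠ 0) (μ : ℝ) :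
    ∫ x, gaussianPDFReal 0 s x * (∫ y, imhAcceptQ (gaussianPDFReal 0 s) (gaussianPDFReal μ s) x y
        * gaussianPDFReal μ s y)
      = ∫ h, min 1 (Real.exp (-h)) ∂(gaussianReal (μ ^ 2 / s) (2 * (μ ^ 2 / (s : ℝ))).toNNReal) := by
  have h0 : ∀ x, 0 < gaussianPDFReal 0 s x := fun x => gaussianPDFReal_pos 0 s x hs
  have hμ0 : ∀ x, 0 < gaussianPDFReal μ s x := fun x => gaussianPDFReal_pos μ s x hs
  have hΔm : Measurable (deltaH (fun z : ℝ × ℝ => -Real.log (gaussianPDFReal 0 s z.1)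
      - Real.log (gaussianPDFReal μ s z.2)) Prod.swap) := by
    rw [show deltaH (fun z : ℝ × ℝ => -Real.log (gaussianPDFReal 0 s z.1) - Real.log (gaussianPDFReal μ s z.2))
        Prod.swap = fun z => μ / s * (z.2 - z.1) from funext (gaussianShift_deltaH_eq hs μ)]
    exact measurable_const.mul (measurable_snd.sub measurable_fst)
  rw [imh_meanAccept_eq_integral_swap (μ := volume) h0 (measurable_gaussianPDFReal 0 s)
    (integrable_gaussianPDFReal 0 s) hμ0 (measurable_gaussianPDFReal μ s) (integrable_gaussianPDFReal μ s)]
  simp_rw [swapEnergy_exp_neg h0 hμ0]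
  rw [integral_mul_gaussianPair_densities hs μ (fun z => min 1 (Real.exp (-deltaH (fun z : ℝ × ℝ =>
      -Real.log (gaussianPDFReal 0 s z.1) - Real.log (gaussianPDFReal μ s z.2)) Prod.swap z))),
    ← gaussianShift_deltaH_law hs μ]
  have hg : Measurable (fun h : ℝ => min 1 (Real.exp (-h))) :=
    measurable_const.min (Real.continuous_exp.measurable.comp measurable_neg)
  rw [integral_map hΔm.aemeasurable hg.aestronglyMeasurable]

/-- **THE BIAS LAW OF A GAUSSIAN FLOW ON A GAUSSIAN MODE**: for target `N(0,s)` and model `N(μ,s)`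
(`s > 0`, any `μ`), the exact flow sampler's equilibrium acceptance is `ā = 2Φ(−|μ|/√(2s))`
(`= erfc(|μ|/(2√s))`); `μ = 0` is the perfect model (`ā = 2Φ(0) = 1`). -/
theorem gaussianShift_meanAccept (hs : s ≠ 0) (μ : ℝ) :
    ∫ x, gaussianPDFReal 0 s x * (∫ y, imhAcceptQ (gaussianPDFReal 0 s) (gaussianPDFReal μ s) x y
        * gaussianPDFReal μ s y)
      = 2 * (gaussianReal (0 : ℝ) 1).real (Iic (-(|μ| / Real.sqrt (2 * s)))) := by
  have hs' : (0 : ℝ) < s := by exact_mod_cast pos_iff_ne_zero.mpr hs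
  rw [gaussianShift_meanAccept_eq_integral_law hs μ]
  rcases eq_or_ne μ 0 with hμ | hμ
  · subst hμ
    have hv : (2 * ((0 : ℝ) ^ 2 / (s : ℝ))).toNNReal = 0 := by simp
    rw [hv, gaussianReal_zero_var, integral_dirac]
    norm_num [Scoring.CardConsistency.gaussianReal_real_Iic_zero]
  · have hm : 0 < μ ^ 2 / s := by positivity
    rw [GaussianDeltaH.integral_min_one_exp_neg_gaussianReal_creutz_std (μ ^ 2 / s) _
      (Real.coe_toNNReal _ (by positivity)) hm]
    congr 3
    rw [neg_inj, div_div, show (s : ℝ) * 2 = 2 * s by ring, Real.sqrt_div' _ (by positivity),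
      Real.sqrt_sq_eq_abs]

/-- **`⟨ΔH⟩ = μ²/s`**: the mean violation of the swap — the Jeffreys divergence
`D(N(0,s)‖N(μ,s)) + D(N(μ,s)‖N(0,s))` of the mode law and the model. -/
theorem gaussianShift_meanDeltaH (hs : s ≠ 0) (μ : ℝ) :
    ∫ z, deltaH (fun z : ℝ × ℝ => -Real.log (gaussianPDFReal 0 s z.1) - Real.log (gaussianPDFReal μ s z.2))
        Prod.swap z * (gaussianPDFReal 0 s z.1 * gaussianPDFReal μ s z.2) ∂((volume : Measure ℝ).prod volume)
      = μ ^ 2 / s := by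
  have hΔm : Measurable (deltaH (fun z : ℝ × ℝ => -Real.log (gaussianPDFReal 0 s z.1)
      - Real.log (gaussianPDFReal μ s z.2)) Prod.swap) := by
    rw [show deltaH (fun z : ℝ × ℝ => -Real.log (gaussianPDFReal 0 s z.1) - Real.log (gaussianPDFReal μ s z.2))
        Prod.swap = fun z => μ / s * (z.2 - z.1) from funext (gaussianShift_deltaH_eq hs μ)]
    exact measurable_const.mul (measurable_snd.sub measurable_fst)
  have hid : AEStronglyMeasurable (fun x : ℝ => x)
      (((gaussianReal 0 s).prod (gaussianReal μ s)).map (deltaH (fun z : ℝ × ℝ =>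
        -Real.log (gaussianPDFReal 0 s z.1) - Real.log (gaussianPDFReal μ s z.2)) Prod.swap)) :=
    measurable_id.aestronglyMeasurable
  rw [integral_mul_gaussianPair_densities hs μ, ← integral_id_gaussianReal (μ := μ ^ 2 / s)
      (v := (2 * (μ ^ 2 / (s : ℝ))).toNNReal), ← gaussianShift_deltaH_law hs μ,
    integral_map hΔm.aemeasurable hid]

/-- **`ā = 2Φ(−√(⟨ΔH⟩/2))`** — the Gaussian-`ΔH` (`erfc`) law of `GaussianDeltaHModel` /
`AcceptanceGaussianEnergyViolation`, holding here EXACTLY because the violation IS Gaussian. -/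
theorem gaussianShift_meanAccept_eq_meanEnergyViolation (hs : s ≠ 0) (μ : ℝ) :
    ∫ x, gaussianPDFReal 0 s x * (∫ y, imhAcceptQ (gaussianPDFReal 0 s) (gaussianPDFReal μ s) x y
        * gaussianPDFReal μ s y)
      = 2 * (gaussianReal (0 : ℝ) 1).real (Iic (-Real.sqrt ((μ ^ 2 / s) / 2))) := by
  have hs' : (0 : ℝ) < s := by exact_mod_cast pos_iff_ne_zero.mpr hs
  rw [gaussianShift_meanAccept hs μ, div_div, show (s : ℝ) * 2 = 2 * s by ring,
    Real.sqrt_div' _ (by positivity), Real.sqrt_sq_eq_abs]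

/-- The Gaussian floor in the mean violation: `1 − √(⟨ΔH⟩/π) ≤ ā` (`GaussianDeltaHModel`). -/
theorem gaussianShift_meanAccept_ge (hs : s ≠ 0) (μ : ℝ) :
    1 - Real.sqrt ((μ ^ 2 / s) / π)
      ≤ ∫ x, gaussianPDFReal 0 s x * (∫ y, imhAcceptQ (gaussianPDFReal 0 s) (gaussianPDFReal μ s) x y
          * gaussianPDFReal μ s y) := by
  have hs' : (0 : ℝ) < s := by exact_mod_cast pos_iff_ne_zero.mpr hs
  rw [gaussianShift_meanAccept_eq_integral_law hs μ]
  rcases eq_or_ne μ 0 with hμ | hμ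
  · subst hμ
    have hv : (2 * ((0 : ℝ) ^ 2 / (s : ℝ))).toNNReal = 0 := by simp
    rw [hv, gaussianReal_zero_var, integral_dirac]
    norm_num
  · have hm : 0 < μ ^ 2 / s := by positivity
    exact GaussianDeltaH.integral_min_one_exp_neg_gaussianReal_creutz_ge (μ ^ 2 / s) _
      (Real.coe_toNNReal _ (by positivity)) hm

/-! ## §4 At equal mean violation the bias law and the width law DIFFER -/

/-- `e^{−1/2} < 5/8` (`(8/5)² = 2.56 < e`). -/
private theorem exp_neg_half_lt : Real.exp (-1 / 2) < 5 / 8 := by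
  have h2 : Real.exp (1 / 2) ^ 2 = Real.exp 1 := by
    rw [← Real.exp_nat_mul]; norm_num
  have hgt : (8 : ℝ) / 5 < Real.exp (1 / 2) := by
    have h1 := Real.exp_one_gt_d9
    exact lt_of_pow_lt_pow_left₀ 2 (Real.exp_pos _).le (by rw [h2]; linarith)
  rw [show (-1 : ℝ) / 2 = -(1 / 2) by ring, Real.exp_neg]
  rw [inv_lt_comm₀ (Real.exp_pos _) (by norm_num)]
  linarith

/-- `1/√(2π) < 2/5` (`2π > 6.25`). -/
private theorem inv_sqrt_two_pi_lt : (Real.sqrt (2 * π))⁻¹ < 2 / 5 := by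
  have hπ := Real.pi_gt_d2
  have h52 : (5 : ℝ) / 2 < Real.sqrt (2 * π) := by
    rw [show (5 : ℝ) / 2 = Real.sqrt ((5 / 2) ^ 2) by rw [Real.sqrt_sq (by norm_num)]]
    exact Real.sqrt_lt_sqrt (by positivity) (by nlinarith)
  rw [inv_lt_comm₀ (Real.sqrt_pos.mpr (by positivity)) (by norm_num)]
  linarith

/-- **`2Φ(−1) < 1/2 = 1 − (2/π)·arctan 1`**: at the common mean violation `⟨ΔH⟩ = 2` a BIASED Gaussian
flow (`μ²/s = 2`, law `2Φ(−√(⟨ΔH⟩/2)) = 2Φ(−1)`) is accepted strictly less often than a MIS-SIZED one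
(`(s − t)²/(2st) = 2`, law `1 − (2/π)·arctan √(⟨ΔH⟩/2) = 1/2`): the flow arm's acceptance column is
not a function of the mean violation alone.  (Gordon's bound `Φ̄(1) ≤ φ(1)` from the Literature toolbox
`GaussianTail.mul_tail_le_pdf`, and `φ(1) = e^{−1/2}/√(2π) < (5/8)(2/5) = 1/4`.) -/
theorem biasLaw_lt_widthLaw_at_two :
    2 * (gaussianReal (0 : ℝ) 1).real (Iic (-Real.sqrt (2 / 2)))
      < 1 - 2 / π * Real.arctan (Real.sqrt (2 / 2)) := by
  rw [div_self (two_ne_zero), Real.sqrt_one, Real.arctan_one]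
  have hπ : π ≠ 0 := Real.pi_pos.ne'
  rw [show 1 - 2 / π * (π / 4) = (1 : ℝ) / 2 by field_simp; ring]
  -- `Φ(−1) = Φ̄(1)` by reflection
  have hsymm : (gaussianReal (0 : ℝ) 1).map (fun y => -y) = gaussianReal 0 1 := by
    rw [gaussianReal_map_neg, neg_zero]
  have hrefl : (gaussianReal (0 : ℝ) 1).real (Iic (-1)) = (gaussianReal (0 : ℝ) 1).real (Ici 1) := by
    conv_lhs => rw [← hsymm]
    rw [map_measureReal_apply measurable_neg measurableSet_Iic]
    congr 1
    ext x
    simp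
  have hIci : (gaussianReal (0 : ℝ) 1).real (Ici 1) = (gaussianReal (0 : ℝ) 1).real (Ioi 1) := by
    haveI := nullSingletonClass_gaussianReal (μ := (0 : ℝ)) one_ne_zero
    exact measureReal_congr Ioi_ae_eq_Ici.symm
  rw [hrefl, hIci]
  have hG := Literature.Probability.HeavyTails.GaussianTail.mul_tail_le_pdf 1
  rw [one_mul] at hG
  have hφ : gaussianPDFReal 0 1 1 = (Real.sqrt (2 * π))⁻¹ * Real.exp (-1 / 2) := by
    rw [gaussianPDFReal_def]
    norm_num
  have h1 := exp_neg_half_lt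
  have h2 := inv_sqrt_two_pi_lt
  have h3 : (Real.sqrt (2 * π))⁻¹ * Real.exp (-1 / 2) < 2 / 5 * (5 / 8) :=
    mul_lt_mul'' h2 h1 (inv_nonneg.mpr (Real.sqrt_nonneg _)) (Real.exp_pos _).le
  linarith

end GaussianShift

end Summit.Ventures.LatticeQCDFlow.Exactness
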